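import Summits.Ventures.PercRepro.S1CoreCapEightExactChain

/-!
# PercRepro — THE AVERAGING CHAIN FROM THE EXACT `s₄ ≤ 87`, CONTINUED TO NULLITY `20` (p8, gen 23; a feeder for S4 —
the rows `38` and below of the `q = 7` window: the cell `(38, 14)` needs `s₄(14) ≤ 474`)

p1 g29's recursion (`S1CoreCapAvg`: `ncard_fourCircuits_sub_div_le` + `le_mul_div_of_sub_div_le`, `s₄ ≤ ⌊(d + 6) · B / (d + 2)⌋`
at nullity `d + 1` from `s₄ ≤ B` at nullity `d`) iterated from `369` at nullity `13` (`S1CoreCapEightExactChain`), value by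
value and without a new definition: `s₄ ≤ 467, 583, 720, 880, 1065, 1278, 1521` at `ν = 14, …, 20` (T4⁺: `812, 988, 1188, 1413, 1665, 1945, 2255`).
Axioms: standard.
-/

open scoped Matroid

namespace PercRepro

namespace S1

open Set

open FourCap

variable {α : Type}

/-- **`s₄ ≤ 467` on every e-free core of nullity `14`**: `⌊19 · 369 / 15⌋ = 467` (T4⁺ gives `812`). -/
theorem ncard_fourCircuits_le_four_hundred_sixty_seven (M : Matroid α) [M.Finite]
    (hfree : ∀ e ∈ M.E, ∃ A ⊆ M.E \ {e}, e ∉ M.closure A ∧ e ∉ M.closure ((M.E \ {e}) \ A))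
    (hd : M.E.encard = M.eRank + 14) : {C : Set α | M.IsCircuit C ∧ C.ncard = 4}.ncard ≤ 467 := by
  have h := ncard_fourCircuits_sub_div_le M hfree (d := 13) hd (by omega)
    (fun M' _ hfree' hd' => ncard_fourCircuits_le_three_hundred_sixty_nine M' hfree' hd')
  exact le_mul_div_of_sub_div_le (m := 13 + 6) (by omega) h

/-- **`s₄ ≤ 583` on every e-free core of nullity `15`**: `⌊20 · 467 / 16⌋ = 583` (T4⁺ gives `988`). -/
theorem ncard_fourCircuits_le_five_hundred_eighty_three (M : Matroid α) [M.Finite]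
    (hfree : ∀ e ∈ M.E, ∃ A ⊆ M.E \ {e}, e ∉ M.closure A ∧ e ∉ M.closure ((M.E \ {e}) \ A))
    (hd : M.E.encard = M.eRank + 15) : {C : Set α | M.IsCircuit C ∧ C.ncard = 4}.ncard ≤ 583 := by
  have h := ncard_fourCircuits_sub_div_le M hfree (d := 14) hd (by omega)
    (fun M' _ hfree' hd' => ncard_fourCircuits_le_four_hundred_sixty_seven M' hfree' hd')
  exact le_mul_div_of_sub_div_le (m := 14 + 6) (by omega) h

/-- **`s₄ ≤ 720` on every e-free core of nullity `16`**: `⌊21 · 583 / 17⌋ = 720` (T4⁺ gives `1188`). -/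
theorem ncard_fourCircuits_le_seven_hundred_twenty (M : Matroid α) [M.Finite]
    (hfree : ∀ e ∈ M.E, ∃ A ⊆ M.E \ {e}, e ∉ M.closure A ∧ e ∉ M.closure ((M.E \ {e}) \ A))
    (hd : M.E.encard = M.eRank + 16) : {C : Set α | M.IsCircuit C ∧ C.ncard = 4}.ncard ≤ 720 := by
  have h := ncard_fourCircuits_sub_div_le M hfree (d := 15) hd (by omega)
    (fun M' _ hfree' hd' => ncard_fourCircuits_le_five_hundred_eighty_three M' hfree' hd')
  exact le_mul_div_of_sub_div_le (m := 15 + 6) (by omega) h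

/-- **`s₄ ≤ 880` on every e-free core of nullity `17`**: `⌊22 · 720 / 18⌋ = 880` (T4⁺ gives `1413`). -/
theorem ncard_fourCircuits_le_eight_hundred_eighty (M : Matroid α) [M.Finite]
    (hfree : ∀ e ∈ M.E, ∃ A ⊆ M.E \ {e}, e ∉ M.closure A ∧ e ∉ M.closure ((M.E \ {e}) \ A))
    (hd : M.E.encard = M.eRank + 17) : {C : Set α | M.IsCircuit C ∧ C.ncard = 4}.ncard ≤ 880 := by
  have h := ncard_fourCircuits_sub_div_le M hfree (d := 16) hd (by omega)
    (fun M' _ hfree' hd' => ncard_fourCircuits_le_seven_hundred_twenty M' hfree' hd')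
  exact le_mul_div_of_sub_div_le (m := 16 + 6) (by omega) h

/-- **`s₄ ≤ 1065` on every e-free core of nullity `18`**: `⌊23 · 880 / 19⌋ = 1065` (T4⁺ gives `1665`). -/
theorem ncard_fourCircuits_le_one_thousand_sixty_five (M : Matroid α) [M.Finite]
    (hfree : ∀ e ∈ M.E, ∃ A ⊆ M.E \ {e}, e ∉ M.closure A ∧ e ∉ M.closure ((M.E \ {e}) \ A))
    (hd : M.E.encard = M.eRank + 18) : {C : Set α | M.IsCircuit C ∧ C.ncard = 4}.ncard ≤ 1065 := by
  have h := ncard_fourCircuits_sub_div_le M hfree (d := 17) hd (by omega)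
    (fun M' _ hfree' hd' => ncard_fourCircuits_le_eight_hundred_eighty M' hfree' hd')
  exact le_mul_div_of_sub_div_le (m := 17 + 6) (by omega) h

/-- **`s₄ ≤ 1278` on every e-free core of nullity `19`**: `⌊24 · 1065 / 20⌋ = 1278` (T4⁺ gives `1945`). -/
theorem ncard_fourCircuits_le_one_thousand_two_hundred_seventy_eight (M : Matroid α) [M.Finite]
    (hfree : ∀ e ∈ M.E, ∃ A ⊆ M.E \ {e}, e ∉ M.closure A ∧ e ∉ M.closure ((M.E \ {e}) \ A))
    (hd : M.E.encard = M.eRank + 19) : {C : Set α | M.IsCircuit C ∧ C.ncard = 4}.ncard ≤ 1278 := by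
  have h := ncard_fourCircuits_sub_div_le M hfree (d := 18) hd (by omega)
    (fun M' _ hfree' hd' => ncard_fourCircuits_le_one_thousand_sixty_five M' hfree' hd')
  exact le_mul_div_of_sub_div_le (m := 18 + 6) (by omega) h

/-- **`s₄ ≤ 1521` on every e-free core of nullity `20`**: `⌊25 · 1278 / 21⌋ = 1521` (T4⁺ gives `2255`). -/
theorem ncard_fourCircuits_le_one_thousand_five_hundred_twenty_one (M : Matroid α) [M.Finite]
    (hfree : ∀ e ∈ M.E, ∃ A ⊆ M.E \ {e}, e ∉ M.closure A ∧ e ∉ M.closure ((M.E \ {e}) \ A))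
    (hd : M.E.encard = M.eRank + 20) : {C : Set α | M.IsCircuit C ∧ C.ncard = 4}.ncard ≤ 1521 := by
  have h := ncard_fourCircuits_sub_div_le M hfree (d := 19) hd (by omega)
    (fun M' _ hfree' hd' => ncard_fourCircuits_le_one_thousand_two_hundred_seventy_eight M' hfree' hd')
  exact le_mul_div_of_sub_div_le (m := 19 + 6) (by omega) h

end S1

end PercRepro
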